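import Literature.Analysis.FluidPDE.LocalTypeIScaling
import Literature.Analysis.FluidPDE.LocalTypeILscPressure
import HarnessLib

/-!
# The blow-down sequence of Albritton–Barker's reverse direction (tools, I)

Trunk T-FLUID (`Literature/Analysis/FluidPDE`), family NS; proofs layer over
`Literature/Analysis/FluidPDE/LocalTypeI.lean` (Albritton–Barker 2019, Thm 1.1, corrected
rendering `Literature.Analysis.FluidPDE.AlbrittonBarkerTypeICharacterization`). No new
definitions.

Albritton–Barker 2019, §3, reverse direction: given a mild bounded ancient solution `v` with
`𝐈 < ∞`, "by translating in space-time as necessary, we have `‖v‖_{L^∞(Q)} = N > 0`", and along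
the blow-down sequence `v^{(k)}(x, t) = k v(k x, k² t)` one has
`‖v^{(k)}‖_{L^∞(Q(1/k))} = k N → ∞`. This file supplies, for the tree's renderings (zoom written
with the accepted `c • stPull (c²) c t₁ x₁ u` of `SpaceTimeRescaling.lean`):

* `cknAEss_le_abScaledSum`, …, `cknE_le_abScaledSum`: each of `A, C, D, E` is at most their
  sum; `parabolicCylinder_subset_lowerHalf`, `fst_nonpos_of_parabolicCylinder_subset`,
  `volume_parabolicCylinder_ne_top`: elementary geometry of parabolic balls;
* `cknDOsc_sub_fun_time` (`_of_integrableOn`): the mean-free pressure quantity `D` does not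
  see functions of time;
* `exists_center_eLpNorm_top_ne_zero`: a field that is not a.e. zero on `ℝ³ × ℝ₋` has a
  parabolic ball `Q(z₁, 1)`, `t₁ < 0`, on which its `L^∞` norm is nonzero (the translation step);
* `tendsto_eLpNorm_top_nsZoom_atTop`: along zoom factors `c_k → ∞` about such a `z₁`,
  `‖v_{c_k}‖_{L^∞(Q(0, R))} → ∞` for every `R > 0`.

The zoomed triple itself is treated in `LocalTypeIReverseZoom.lean`.

## References

* D. Albritton, T. Barker, *On local Type I singularities of the Navier–Stokes equations and
  Liouville theorems*, J. Math. Fluid Mech. 21 (2019), arXiv:1811.00502, §3 (proof of Thm 1.1,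
  reverse direction).
-/

noncomputable section

open MeasureTheory Set Function Filter Topology TopologicalSpace Metric
open scoped NNReal ENNReal InnerProductSpace RealInnerProductSpace

namespace Literature.Analysis.FluidPDE

/-! ### Elementary facts -/

section Elementary

variable {r : ℝ} {z : ℝ × EuclideanSpace ℝ (Fin 3)}
  {u : ℝ → EuclideanSpace ℝ (Fin 3) → EuclideanSpace ℝ (Fin 3)}
  {p : ℝ → EuclideanSpace ℝ (Fin 3) → ℝ}
  {G : ℝ → EuclideanSpace ℝ (Fin 3) → EuclideanSpace ℝ (Fin 3) →L[ℝ] EuclideanSpace ℝ (Fin 3)}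

/-- `A ≤ A + C + D + E`. [folklore] -/
theorem cknAEss_le_abScaledSum : cknAEss r z u ≤ abScaledSum r z u p G :=
  le_add_right (le_add_right le_self_add)

/-- `C ≤ A + C + D + E`. [folklore] -/
theorem cknC_le_abScaledSum : cknC r z u ≤ abScaledSum r z u p G :=
  le_add_right (le_add_right le_add_self)

/-- `D ≤ A + C + D + E`. [folklore] -/
theorem cknDOsc_le_abScaledSum : cknDOsc r z p ≤ abScaledSum r z u p G :=
  le_add_right le_add_self

/-- `E ≤ A + C + D + E`. [folklore] -/
theorem cknE_le_abScaledSum : cknE r z G ≤ abScaledSum r z u p G :=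
  le_add_self

/-- A parabolic ball `Q(z, r)` with `t ≤ 0` lies in the half space `ℝ³ × ℝ₋`. [folklore] -/
theorem parabolicCylinder_subset_lowerHalf (hz : z.1 ≤ 0) (r : ℝ) :
    parabolicCylinder r z ⊆ Iio (0 : ℝ) ×ˢ (univ : Set (EuclideanSpace ℝ (Fin 3))) := by
  intro w hw
  rw [mem_parabolicCylinder] at hw
  exact ⟨lt_of_lt_of_le hw.1.2 hz, mem_univ _⟩

/-- **`D` does not see functions of time.** If for a.e. `t ∈ (t₀ - r², t₀)` the slice `q(t, ·)`
is integrable on `B(x₀, r)`, then `D(Q(z, r); q - c(t)) = D(Q(z, r); q)` for every `c : ℝ → ℝ`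
(the ball means shift by `c(t)`; Albritton–Barker 2019, §1: the pressure of a mild bounded
ancient solution is determined up to a function of time, "invisible to `D`"). [folklore] -/
theorem cknDOsc_sub_fun_time (hr : 0 < r) {q : ℝ → EuclideanSpace ℝ (Fin 3) → ℝ} (c : ℝ → ℝ)
    (hq : ∀ᵐ t ∂(volume.restrict (Ioo (z.1 - r ^ 2) z.1)),
      IntegrableOn (q t) (ball z.2 r) volume) :
    cknDOsc r z (fun t x => q t x - c t) = cknDOsc r z q := by
  have hB0 : volume (ball z.2 r) ≠ 0 := (measure_ball_pos volume z.2 hr).ne'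
  have hBtop : volume (ball z.2 r) ≠ ∞ := measure_ball_lt_top.ne
  unfold cknDOsc
  congr 1
  refine lintegral_congr_ae ?_
  have hprod : (volume.restrict (parabolicCylinder r z) :
      Measure (ℝ × EuclideanSpace ℝ (Fin 3))) =
      (volume.restrict (Ioo (z.1 - r ^ 2) z.1)).prod (volume.restrict (ball z.2 r)) :=
    volume_restrict_prod_eq _ _
  rw [hprod]
  filter_upwards [(Measure.quasiMeasurePreserving_fst
    (μ := volume.restrict (Ioo (z.1 - r ^ 2) z.1)) (ν := volume.restrict (ball z.2 r))).ae hq]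
    with w hw
  rw [FunctionSpaces.setAverage_sub_const hB0 hBtop hw]
  congr 2
  ring

/-- **The translation step**: a measurable field on `ℝ³ × ℝ₋` which is not a.e. zero has a
parabolic ball `Q(z₁, 1)` with `t₁ < 0` on which its `L^∞` norm does not vanish (the balls
`Q(c, 1)` with centres in a countable dense set and `t < 0` cover `ℝ³ × ℝ₋`).
(Albritton–Barker 2019, §3: "By translating in space-time as necessary, we have
`‖v‖_{L^∞(Q)} = N > 0`.") [cite: AlbrittonBarker2019, §3] -/
theorem exists_center_eLpNorm_top_ne_zero
    (hu : AEStronglyMeasurable (uncurry u)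
      (volume.restrict (Iio (0 : ℝ) ×ˢ (univ : Set (EuclideanSpace ℝ (Fin 3))))))
    (hnt : ¬ (uncurry u =ᵐ[volume.restrict
      (Iio (0 : ℝ) ×ˢ (univ : Set (EuclideanSpace ℝ (Fin 3))))] 0)) :
    ∃ z₁ : ℝ × EuclideanSpace ℝ (Fin 3), z₁.1 < 0 ∧
      eLpNorm (uncurry u) ∞ (volume.restrict (parabolicCylinder 1 z₁)) ≠ 0 := by
  by_contra h
  push Not at h
  apply hnt
  set c := TopologicalSpace.denseSeq (ℝ × EuclideanSpace ℝ (Fin 3)) with hc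
  have hdense : DenseRange c := TopologicalSpace.denseRange_denseSeq _
  set S : Set (ℝ × EuclideanSpace ℝ (Fin 3)) :=
    ⋃ n ∈ {n : ℕ | (c n).1 < 0}, parabolicCylinder 1 (c n) with hS
  -- the balls cover the half space
  have hcover : Iio (0 : ℝ) ×ˢ (univ : Set (EuclideanSpace ℝ (Fin 3))) ⊆ S := by
    rintro ⟨t, x⟩ ⟨ht, -⟩
    have ht : t < 0 := ht
    set U : Set (ℝ × EuclideanSpace ℝ (Fin 3)) := (Ioo t (min 0 (t + 1))) ×ˢ ball x 1 with hU
    have hUo : IsOpen U := isOpen_Ioo.prod isOpen_ball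
    have hUne : U.Nonempty := by
      refine ⟨((t + min 0 (t + 1)) / 2, x), ⟨?_, ?_⟩, mem_ball_self one_pos⟩
      · show t < (t + min 0 (t + 1)) / 2
        have : t < min 0 (t + 1) := lt_min ht (by linarith)
        linarith
      · show (t + min 0 (t + 1)) / 2 < min 0 (t + 1)
        have : t < min 0 (t + 1) := lt_min ht (by linarith)
        linarith
    obtain ⟨n, hn⟩ := hdense.exists_mem_open hUo hUne
    obtain ⟨⟨hn1, hn2⟩, hn3⟩ := hn
    have hn0 : (c n).1 < 0 := lt_of_lt_of_le hn2 (min_le_left _ _)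
    have hn4 : (c n).1 < t + 1 := lt_of_lt_of_le hn2 (min_le_right _ _)
    refine mem_iUnion₂.2 ⟨n, hn0, ?_⟩
    rw [mem_parabolicCylinder]
    show ((c n).1 - 1 ^ 2 < t ∧ t < (c n).1) ∧ dist x (c n).2 < 1
    refine ⟨⟨by linarith, hn1⟩, ?_⟩
    rw [dist_comm]; exact hn3
  -- on each ball the field vanishes a.e.
  have hball : ∀ n ∈ {n : ℕ | (c n).1 < 0},
      ∀ᵐ w ∂(volume.restrict (parabolicCylinder 1 (c n))), uncurry u w =
        (0 : ℝ × EuclideanSpace ℝ (Fin 3) → EuclideanSpace ℝ (Fin 3)) w := by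
    intro n hn
    have hsub := parabolicCylinder_subset_lowerHalf (z := c n) (le_of_lt hn) 1
    have hmeas : AEStronglyMeasurable (uncurry u) (volume.restrict (parabolicCylinder 1 (c n))) :=
      hu.mono_measure (Measure.restrict_mono hsub le_rfl)
    have h0 := h (c n) hn
    exact (eLpNorm_eq_zero_iff hmeas ENNReal.top_ne_zero).1 h0
  have hS' : ∀ᵐ w ∂(volume.restrict S), uncurry u w =
      (0 : ℝ × EuclideanSpace ℝ (Fin 3) → EuclideanSpace ℝ (Fin 3)) w :=
    (ae_restrict_biUnion_iff _ (Set.to_countable _) _).2 hball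
  exact ae_restrict_of_ae_restrict_of_subset hcover hS'

/-- **Blow-up of the `L^∞` norms along the blow-down sequence** (Albritton–Barker 2019, §3:
`‖v^{(k)}‖_{L^∞(Q(1/k))} = k N → ∞`). If `‖u‖_{L^∞(Q(z₁, 1))} ≠ 0` and `c_k → ∞`, `c_k > 0`, then
for every `R > 0` the zoomed fields `v_k = c_k u(t₁ + c_k² s, x₁ + c_k y)` satisfy
`‖v_k‖_{L^∞(Q(0, R))} → ∞` (for `c_k R ≥ 1`, `‖v_k‖_{L^∞(Q(0,R))} = c_k ‖u‖_{L^∞(Q(z₁, c_k R))}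
≥ c_k ‖u‖_{L^∞(Q(z₁, 1))}`). [cite: AlbrittonBarker2019, §3] -/
theorem tendsto_eLpNorm_top_nsZoom_atTop {z₁ : ℝ × EuclideanSpace ℝ (Fin 3)} {c : ℕ → ℝ}
    (hc : ∀ k, 0 < c k) (hctop : Tendsto c atTop atTop)
    (hN : eLpNorm (uncurry u) ∞ (volume.restrict (parabolicCylinder 1 z₁)) ≠ 0) {R : ℝ}
    (hR : 0 < R) :
    Tendsto (fun k => eLpNorm (uncurry ((c k) • stPull (c k ^ 2) (c k) z₁.1 z₁.2 u)) ∞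
      (volume.restrict (parabolicCylinder R 0))) atTop (𝓝 ∞) := by
  set N := eLpNorm (uncurry u) ∞ (volume.restrict (parabolicCylinder 1 z₁)) with hNdef
  -- the comparison sequence `c_k N → ∞`
  have hb : Tendsto (fun k => ENNReal.ofReal (c k) * N) atTop (𝓝 ∞) := by
    have h1 : Tendsto (fun k => ENNReal.ofReal (c k)) atTop (𝓝 ∞) :=
      ENNReal.tendsto_ofReal_atTop.comp hctop
    have h2 := ENNReal.Tendsto.mul_const h1 (Or.inl ENNReal.top_ne_zero) (b := N)
    rwa [ENNReal.top_mul hN] at h2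
  refine tendsto_nhds_top_mono hb ?_
  filter_upwards [hctop.eventually_ge_atTop R⁻¹] with k hk
  have hcR : 1 ≤ c k * R := by
    have := mul_le_mul_of_nonneg_right hk hR.le
    rwa [inv_mul_cancel₀ hR.ne'] at this
  have h0 : stAffine (c k ^ 2) (c k) z₁.1 z₁.2 0 = z₁ := by
    ext <;> simp [stAffine]
  rw [eLpNorm_top_nsZoom (hc k) z₁.1 z₁.2 R 0, h0]
  gcongr
  refine eLpNorm_mono_measure _ (Measure.restrict_mono ?_ le_rfl)
  -- `Q(z₁, 1) ⊆ Q(z₁, c_k R)`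
  have h2 : (1 : ℝ) ^ 2 ≤ (c k * R) ^ 2 := pow_le_pow_left₀ zero_le_one hcR 2
  exact prod_mono (Ioo_subset_Ioo (by linarith) le_rfl) (ball_subset_ball hcR)

/-- If `Q(z, r) ⊆ Q(0, R)` with `r > 0` then `t ≤ 0` (the times `t - ε` belong to `Q(z, r)`).
[folklore] -/
theorem fst_nonpos_of_parabolicCylinder_subset (hr : 0 < r) {R : ℝ}
    (h : parabolicCylinder r z ⊆ parabolicCylinder R (0 : ℝ × EuclideanSpace ℝ (Fin 3))) :
    z.1 ≤ 0 := by
  by_contra hz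
  push Not at hz
  set ε := min (r ^ 2 / 2) (z.1 / 2) with hε
  have hε0 : 0 < ε := lt_min (by positivity) (by linarith)
  have hε1 : ε ≤ r ^ 2 / 2 := min_le_left _ _
  have hε2 : ε ≤ z.1 / 2 := min_le_right _ _
  have hw : (z.1 - ε, z.2) ∈ parabolicCylinder r z := by
    rw [mem_parabolicCylinder]
    exact ⟨⟨by dsimp only; nlinarith [sq_nonneg r], by dsimp only; linarith⟩,
      by simpa using hr⟩
  have hw' := h hw
  rw [mem_parabolicCylinder] at hw'
  have : z.1 - ε < 0 := by simpa using hw'.1.2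
  linarith

/-- Parabolic balls have finite volume (they lie in the compact `[t - r², t] × B̄(x, r)`).
[folklore] -/
theorem volume_parabolicCylinder_ne_top (r : ℝ) (z : ℝ × EuclideanSpace ℝ (Fin 3)) :
    volume (parabolicCylinder r z) ≠ ∞ := by
  refine (lt_of_le_of_lt (measure_mono (Set.prod_mono Ioo_subset_Icc_self
    (ball_subset_closedBall : ball z.2 r ⊆ closedBall z.2 r))) ?_).ne
  exact (isCompact_Icc.prod (isCompact_closedBall z.2 r)).measure_lt_top

/-- `D` does not see functions of time, integrable version: if `q` is integrable on `Q(z, r)`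
then `D(Q(z, r); q - c(t)) = D(Q(z, r); q)`. [folklore] -/
theorem cknDOsc_sub_fun_time_of_integrableOn (hr : 0 < r)
    {q : ℝ → EuclideanSpace ℝ (Fin 3) → ℝ} (c : ℝ → ℝ)
    (hq : IntegrableOn (uncurry q) (parabolicCylinder r z) volume) :
    cknDOsc r z (fun t x => q t x - c t) = cknDOsc r z q := by
  refine cknDOsc_sub_fun_time hr c ?_
  have hq' : Integrable (uncurry q)
      ((volume.restrict (Ioo (z.1 - r ^ 2) z.1)).prod (volume.restrict (ball z.2 r))) := by
    rw [← volume_restrict_prod_eq]; exact hq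
  exact hq'.prod_right_ae

end Elementary

end Literature.Analysis.FluidPDE
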